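import Summits.BirchSwinnertonDyer.BirchSwinnertonDyer.Theorems.SchneiderFreeAdditiveX3BranchIMCHalves
import HarnessLib

/-!
# Route `SchneiderFreeAdditiveX3` (rung K1 door), cruxes `GordTwoBranchIMC` (item 19177) / `PotMultBranchIMC`
# (item 19176): rev-9/10 CURRENCY of the typed-halves road under `ControlFacts` and `AnticycControlAdditiveKF`

Cell `bsd-schneider-ideate`, seat `bsd-schneider-door-c3` (prover, generation 4). HONEST FRAMING: two
compositions (pure logic) keeping gen 2's typed-halves road
(`Theorems/SchneiderFreeAdditiveX3BranchIMCHalves.lean`) current with the route's rev 9/10 re-typing of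
the control corner: the served control item is now `AnticycControlAdditiveKF` (item
stmt-BirchSwinnertonDyer-19548: the four cite-only Poitou–Tate / class-field-theory facts of `ControlFacts`
= item 19538, then Kolyvagin, then the pointwise control equality), and `h4F hPT hSha hBr hBrA` is
definitionally the rev-6 item `AnticycControlAdditiveK` (19295, now support), so gen 2's
`…_of_anticycControlAdditiveK_of_typedHalves` applies verbatim. NOTHING is asserted about elliptic curves;
BSD is not advanced; both branch cruxes stay OPEN (H3 = Keller–Yin arXiv:2410.23241 Thm. 3.5.1 at the frame,
PREPRINT, on (G-ord, `e = 2`); nothing in print on (M)). `--supports` material for item 19177.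

So at rev 10 the open cone of crux r3 reads: H3 (KY24b Thm. 3.5.1, PRE) + H1/H2 (the BDP frame for `f_E`
and its Manin-robust value at 𝟙 — derived from print: Castella–Hsieh 2018 Thm. 5.7 + Lemma 5.4, BDP13,
Gross–Zagier, Cai–Shu–Tian; see this seat's `…BranchIMCRebase*.lean` for the rebased form) + the control
corner (19548 with its four items) + the printed facts.

References: Keller–Yin arXiv:2410.23241 Thm. 3.5.1 (p. 20); Jetchev–Skinner–Wan 2017 §7.4.1; Milne ADT I
4.10; Brink 2007 Thm. 2 / Cor. 1.
-/

noncomputable section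

open scoped Classical

open WeierstrassCurve NumberField IsDedekindDomain Field
  Literature.NumberTheory.EllipticCurves
  Literature.NumberTheory.EllipticCurves.ModularForms
  Literature.NumberTheory.EllipticCurves.GreenbergSelmer
  Literature.NumberTheory.EllipticCurves.Rank1Residual
  Literature.NumberTheory.EllipticCurves.Rank1Residual.Typed
  Summit.BirchSwinnertonDyer.Rank1Residual
  Summit.BirchSwinnertonDyer.Rank1Residual.X11b
  Summit.BirchSwinnertonDyer.Rank1Residual.X11b.AcSelmer
  Summit.BirchSwinnertonDyer.Rank1Residual.X11b.Halves

-- D-0017 layout: summit = sub-problem, so `Summit.BirchSwinnertonDyer.BirchSwinnertonDyer.…` is the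
-- mandated namespace (same option as the route's sockets files).
set_option linter.dupNamespace false
set_option autoImplicit false

namespace Summit.BirchSwinnertonDyer.BirchSwinnertonDyer.Theorems.SchneiderFree

/-! ## §3 Route rev 9/10 currency: the crux BY NAME from `ControlFacts` + Kolyvagin + `AnticycControlAdditiveKF` + the typed halves -/

/-- **`GordTwoBranchIMC` (item 19177) ⇐ `ControlFacts` ∧ Kolyvagin ∧ `AnticycControlAdditiveKF` ∧ H1 ∧ H2
∧ H3 on the (G-ord, `e = 2`) cell** — the rev-9/10 form of gen 2's
`gordTwoBranchIMC_of_anticycControlAdditiveK_of_typedHalves`: the served control item (19548) is the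
control equality UNDER the four cite-only facts of `ControlFacts` (item 19538) and Kolyvagin, and
`h4F hPT hSha hBr hBrA` is definitionally the rev-6 item `AnticycControlAdditiveK`. So the crux's
open cone at rev 10 reads: KY24b Thm. 3.5.1 at the frame (H3, PRE) + the BDP frame and its value at 𝟙
(H1, H2: derived from print) + the control corner + the printed facts. CONDITIONAL on all listed
hypotheses; nothing asserted. [cite: KellerYin2024b, Thm. 3.5.1 (arXiv:2410.23241 p. 20) (shape only; preprint)]
[cite: JetchevSkinnerWan2017, §7.4.1 (arXiv:1512.06894 p. 30)] -/
theorem gordTwoBranchIMC_of_controlFacts_of_anticycControlAdditiveKF_of_typedHalves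
    (hCF : Theses.SchneiderFreeAdditiveX3.ControlFacts)
    (hKo : ∀ (N : ℕ) [NeZero N] (W : WeierstrassCurve ℚ) (K : Type) [Field K] [NumberField K],
      Literature.NumberTheory.EllipticCurves.kolyvagin N W K)
    (h4F : Theses.SchneiderFreeAdditiveX3.AnticycControlAdditiveKF)
    (h1 : ∀ (W : WeierstrassCurve ℚ) [W.IsElliptic] [W.IsGloballyMinimal] (p : ℕ) [Fact p.Prime],
      W.analyticRank = 1 → p ≠ 2 → ClassX3 W p → Additive.SubGordTwo W p → BranchBDPExistsAt W p)
    (h2 : ∀ (W : WeierstrassCurve ℚ) [W.IsElliptic] [W.IsGloballyMinimal] (p : ℕ) [Fact p.Prime],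
      W.analyticRank = 1 → p ≠ 2 → ClassX3 W p → Additive.SubGordTwo W p → BranchBDPValueLeAt W p)
    (h3 : ∀ (W : WeierstrassCurve ℚ) [W.IsElliptic] [W.IsGloballyMinimal] (p : ℕ) [Fact p.Prime],
      W.analyticRank = 1 → p ≠ 2 → ClassX3 W p → Additive.SubGordTwo W p → BranchIMCDivAt W p) :
    Theses.SchneiderFreeAdditiveX3.GordTwoBranchIMC := by
  obtain ⟨hPT, hSha, hBr, hBrA⟩ := hCF
  exact gordTwoBranchIMC_of_anticycControlAdditiveK_of_typedHalves hKo (h4F hPT hSha hBr hBrA) h1 h2 h3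

/-- **`PotMultBranchIMC` (item 19176) ⇐ `ControlFacts` ∧ Kolyvagin ∧ `AnticycControlAdditiveKF` ∧ H1 ∧
H2 ∧ H3 on the (M) cell** — the (M) twin (on (M) no H3 is in print; Keller–Yin name the potentially
multiplicative case future work, arXiv:2410.23241 p. 15). CONDITIONAL; nothing asserted.
[cite: KellerYin2024b, §3.1 Case II (arXiv:2410.23241 pp. 13–15) (scope statement only)] -/
theorem potMultBranchIMC_of_controlFacts_of_anticycControlAdditiveKF_of_typedHalves
    (hCF : Theses.SchneiderFreeAdditiveX3.ControlFacts)
    (hKo : ∀ (N : ℕ) [NeZero N] (W : WeierstrassCurve ℚ) (K : Type) [Field K] [NumberField K],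
      Literature.NumberTheory.EllipticCurves.kolyvagin N W K)
    (h4F : Theses.SchneiderFreeAdditiveX3.AnticycControlAdditiveKF)
    (h1 : ∀ (W : WeierstrassCurve ℚ) [W.IsElliptic] [W.IsGloballyMinimal] (p : ℕ) [Fact p.Prime],
      W.analyticRank = 1 → p ≠ 2 → ClassX3 W p → Additive.SubM W p → BranchBDPExistsAt W p)
    (h2 : ∀ (W : WeierstrassCurve ℚ) [W.IsElliptic] [W.IsGloballyMinimal] (p : ℕ) [Fact p.Prime],
      W.analyticRank = 1 → p ≠ 2 → ClassX3 W p → Additive.SubM W p → BranchBDPValueLeAt W p)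
    (h3 : ∀ (W : WeierstrassCurve ℚ) [W.IsElliptic] [W.IsGloballyMinimal] (p : ℕ) [Fact p.Prime],
      W.analyticRank = 1 → p ≠ 2 → ClassX3 W p → Additive.SubM W p → BranchIMCDivAt W p) :
    Theses.SchneiderFreeAdditiveX3.PotMultBranchIMC := by
  obtain ⟨hPT, hSha, hBr, hBrA⟩ := hCF
  exact potMultBranchIMC_of_anticycControlAdditiveK_of_typedHalves hKo (h4F hPT hSha hBr hBrA) h1 h2 h3

end Summit.BirchSwinnertonDyer.BirchSwinnertonDyer.Theorems.SchneiderFree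

end
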